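import Summits.QuantumFields.BalabanUV.T4Continuum.Support.NE7MinActHessianLagrangianAllData
import Summits.QuantumFields.BalabanUV.T4Continuum.Support.NE7SecondVariationHess
import HarnessLib

/-!
# NE7MinActHessianHessForm — THE BORDERED HESSIAN OF THE CONSTRAINED MINIMAL ACTION IN THE TREE's HESSIAN CURRENCY (ROAD-G115 §6 (vii))

✓ `NE7MinActHessianLagrangianAllData.minAct_hessian_lagrangian_allData` with the `𝒜`-term rewritten through ✓ `NE7SecondVariationHess.second_variation`: for `d = 4`, every `U(n)`,
`L ≥ 2`, `0 < ε ≤ ε₀`, `N ≥ 1`, every level `j+1` there is `δ_V > 0` such that for every `δ_V`-small unitary `N`-periodic datum `V₀` and every minimiser `U♯` over it, with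
`m = minAct∘chart_{V₀}`, `𝒢 = levelQ∘chart_{U♯}`, `Q′ = levelQ′ L N j U♯`, `W` the plaquettes of the period box, `w = stepWt⁻ʲ⁻¹`:
  `D²m(0)[v, v] = min { w·hess U♯ X̃ X̃ W − Dm(0)[D²𝒢(0)[X, X]] : X ∈ skewSub M, Q′X = v }`, `X̃ = chartDir X`, the minimum attained (**`minAct_hessian_hessForm_allData`**) —
the quantity minimised is row NE3's mixed Hessian form `hess` (✓ `NE3HessForm`; bounds ✓ `NE3HessBounds`) of the Wilson action at the background `U♯ = U_{j+1}(V₀)`, corrected by the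
multiplier term (✓ `NE7MinActMultiplier`: `Dm(0)∘Q′ = w·D𝒜(0)`).
Cell `pub-balaban`, rung (B)+1 sub-cell t4, lineage `b2b-balaban-t4-ne7-p1` (CRUX PROVER NE7 #1 = OWNER of BINDER row NE7), generation 115.  Memo `t4/b2b-balaban-t4-ne7-p1-g115/ROAD-G115.md` §6.
WHAT ([folklore]; 0 def, 0 sorry; `d = 4`, every `U(n)`, `L ≥ 2`).  HONEST FRAMING (page 1): a restatement (currency change) of a landed theorem; ∀ j ∃ δ_V; constants existential; variational
characterisation only; OUR minimisers; nothing of Bałaban's asserted; NOT NE7 as a spine node, NOT NE3; spine 0∕9; NOT infinite volume, NOT mass gap, NOT BetaPertH, NOT Clay.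
-/

set_option autoImplicit false

open scoped BigOperators Matrix Matrix.Norms.L2Operator Topology
open NormedSpace Finset Set Filter Metric

namespace Summit.QuantumFields.BalabanUV.T4Continuum.NE7MinActHessianHessForm

open Literature.MathematicalPhysics.QuantumFieldTheory.Balaban1983to89
open B7Prop1Explicit B7Prop2Explicit
open T4AveragingDeficitWall (IsUnitaryCfg SmallField fineAction)
open T4AveragingDeficitWallBoundary (IsPeriodicCfg)
open AveragingDeficitTorusChart (TDir chart chartDir)
open AveragingDeficitTwoLevelPrep (skewSub)
open AveragingDeficitMultiLevelPrep (tower levelQ levelQ' tower_ne_zero)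
open MinimalActionLevels (perWin stepWt)
open MinimalActionSandwich (IsMinimiser minAct)
open MinimalActionRate (sfClass)
open NE3HessForm (hess)
open NE7MinActHessianLagrangianAllData (minAct_hessian_lagrangian_allData)
open NE7SecondVariationHess (second_variation)

noncomputable section

variable {n : Type} [Fintype n] [DecidableEq n]

/-- **THE BORDERED HESSIAN IN `hess` CURRENCY, AT EVERY SMALL DATUM, UNCONDITIONALLY** (see the module docstring). [folklore] -/
theorem minAct_hessian_hessForm_allData [Nonempty n] {L : ℕ} [NeZero L] (hL : 2 ≤ L) :
    ∃ ε₀ : ℝ, 0 < ε₀ ∧ ∀ ε : ℝ, 0 < ε → ε ≤ ε₀ → ∀ (N : ℕ) [NeZero N], 1 ≤ N → ∀ j : ℕ,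
      ∃ δV : ℝ, 0 < δV ∧
        ∀ V₀ ∈ {V : Site 4 → Fin 4 → (Matrix n n ℂ)ˣ | IsUnitaryCfg V ∧ IsPeriodicCfg V (N : ℤ) ∧ SmallField V δV},
        (∃ Us : Site 4 → Fin 4 → (Matrix n n ℂ)ˣ, IsMinimiser 4 (sfClass 4 L N ε) L N (j + 1) V₀ Us) ∧
        ∀ Us : Site 4 → Fin 4 → (Matrix n n ℂ)ˣ, IsMinimiser 4 (sfClass 4 L N ε) L N (j + 1) V₀ Us →
        ContDiffAt ℝ 2 (fun y : ↥(skewSub 4 n N) => minAct 4 (sfClass 4 L N ε) L N (j + 1) (chart (ContinuousLinearMap.id ℝ (Matrix n n ℂ)) N V₀ (y : TDir 4 n N))) 0 ∧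
        ∀ v : ↥(skewSub 4 n N),
          IsLeast {q : ℝ | ∃ X : ↥(skewSub 4 n (L * tower L N j)), levelQ' L N j Us (X : TDir 4 n (L * tower L N j)) = v ∧
              q = ((stepWt 4 L)⁻¹) ^ (j + 1) * hess Us (chartDir (ContinuousLinearMap.id ℝ (Matrix n n ℂ)) (L * tower L N j) (X : TDir 4 n (L * tower L N j))) (chartDir (ContinuousLinearMap.id ℝ (Matrix n n ℂ)) (L * tower L N j) (X : TDir 4 n (L * tower L N j))) (perWin 4 (N * L ^ (j + 1)))
                  - fderiv ℝ (fun y : ↥(skewSub 4 n N) => minAct 4 (sfClass 4 L N ε) L N (j + 1) (chart (ContinuousLinearMap.id ℝ (Matrix n n ℂ)) N V₀ (y : TDir 4 n N))) 0 (fderiv ℝ (fderiv ℝ (fun Φ : ↥(skewSub 4 n (L * tower L N j)) => levelQ L N j Us (chart (ContinuousLinearMap.id ℝ (Matrix n n ℂ)) (L * tower L N j) Us (Φ : TDir 4 n (L * tower L N j))))) 0 X X)}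
            (fderiv ℝ (fderiv ℝ (fun y : ↥(skewSub 4 n N) => minAct 4 (sfClass 4 L N ε) L N (j + 1) (chart (ContinuousLinearMap.id ℝ (Matrix n n ℂ)) N V₀ (y : TDir 4 n N)))) 0 v v) := by
  obtain ⟨ε₀, hε₀, H⟩ := minAct_hessian_lagrangian_allData (n := n) hL
  refine ⟨ε₀, hε₀, fun ε hε hεle N _ hN j => ?_⟩
  obtain ⟨δV, hδV, hall⟩ := H ε hε hεle N hN j
  refine ⟨δV, hδV, fun V₀ hV₀ => ?_⟩
  obtain ⟨hex, hbord⟩ := hall V₀ hV₀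
  haveI : NeZero (L * tower L N j) := ⟨Nat.mul_ne_zero (NeZero.ne L) (tower_ne_zero L N j)⟩
  refine ⟨hex, fun Us hUs => ?_⟩
  obtain ⟨hC2, hleast⟩ := hbord Us hUs
  refine ⟨hC2, fun v => ?_⟩
  have hset : {q : ℝ | ∃ X : ↥(skewSub 4 n (L * tower L N j)), levelQ' L N j Us (X : TDir 4 n (L * tower L N j)) = v ∧
      q = ((stepWt 4 L)⁻¹) ^ (j + 1) * hess Us (chartDir (ContinuousLinearMap.id ℝ (Matrix n n ℂ)) (L * tower L N j) (X : TDir 4 n (L * tower L N j))) (chartDir (ContinuousLinearMap.id ℝ (Matrix n n ℂ)) (L * tower L N j) (X : TDir 4 n (L * tower L N j))) (perWin 4 (N * L ^ (j + 1)))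
          - fderiv ℝ (fun y : ↥(skewSub 4 n N) => minAct 4 (sfClass 4 L N ε) L N (j + 1) (chart (ContinuousLinearMap.id ℝ (Matrix n n ℂ)) N V₀ (y : TDir 4 n N))) 0 (fderiv ℝ (fderiv ℝ (fun Φ : ↥(skewSub 4 n (L * tower L N j)) => levelQ L N j Us (chart (ContinuousLinearMap.id ℝ (Matrix n n ℂ)) (L * tower L N j) Us (Φ : TDir 4 n (L * tower L N j))))) 0 X X)}
      = {q : ℝ | ∃ X : ↥(skewSub 4 n (L * tower L N j)), levelQ' L N j Us (X : TDir 4 n (L * tower L N j)) = v ∧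
          q = ((stepWt 4 L)⁻¹) ^ (j + 1) * fderiv ℝ (fderiv ℝ (fun Φ : ↥(skewSub 4 n (L * tower L N j)) => fineAction (chart (ContinuousLinearMap.id ℝ (Matrix n n ℂ)) (L * tower L N j) Us (Φ : TDir 4 n (L * tower L N j))) (perWin 4 (N * L ^ (j + 1))))) 0 X X
              - fderiv ℝ (fun y : ↥(skewSub 4 n N) => minAct 4 (sfClass 4 L N ε) L N (j + 1) (chart (ContinuousLinearMap.id ℝ (Matrix n n ℂ)) N V₀ (y : TDir 4 n N))) 0 (fderiv ℝ (fderiv ℝ (fun Φ : ↥(skewSub 4 n (L * tower L N j)) => levelQ L N j Us (chart (ContinuousLinearMap.id ℝ (Matrix n n ℂ)) (L * tower L N j) Us (Φ : TDir 4 n (L * tower L N j))))) 0 X X)} := by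
    ext q
    simp only [Set.mem_setOf_eq, second_variation]
  rw [hset]
  exact hleast v

end

end Summit.QuantumFields.BalabanUV.T4Continuum.NE7MinActHessianHessForm
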